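import Literature.Geometry.Riemannian.GradientSolitonIdentities
import Literature.Geometry.Riemannian.RicciFlowScalarCurvatureComparison
import Literature.Geometry.Lorentzian.HessianLocalMax
import HarnessLib

/-!
# Compact shrinking gradient Ricci solitons have nonnegative scalar curvature

For a `C^∞` Riemannian metric `g` on a compact manifold (without boundary) with its Levi-Civita
connection, and a `C^∞` function `f` with `Ric + Hess f = λ g`, `λ > 0` (a shrinking gradient Ricci
soliton), we PROVE `S ≥ 0` everywhere (`scalarCurvature_nonneg_of_compactSpace_soliton`): at a
minimum point `x₀` of `S` one has `Δ_g S(x₀) ≥ 0` and `dS_{x₀} = 0`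
(`dalembertian_nonneg_of_isLocalMin`, `IsLocalMin.fderiv_eq_zero` in the chart), so Hamilton's identity
`Δ_g S = g⁻¹(dS, df) + 2λS − 2|Ric|²` (`dalembertian_scalarCurvature_of_soliton`,
`GradientSolitonIdentities.lean`) gives `|Ric|²(x₀) ≤ λ S(x₀)`, while `S² ≤ n |Ric|²`
(`trace_sq_le_finrank_mul_normSq`); hence `S(x₀)² ≤ nλ S(x₀)` and `S(x₀) ≥ 0`. This is the first
step of the elliptic proof of the classification of compact shrinking solitons
(Eminenti–La Nave–Mantegazza 2008, §3: "the scalar curvature `R` must be positive everywhere",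
by the strong maximum principle; here the weak inequality from the minimum principle;
Ivey 1993 for `n = 3`; Cao–Chen–Zhu 2008, §4). A corollary spells it out for the binder of
`threeShrinkerClassification_modelData` (`λ = ½`, `n = 3`). Everything is proved; no definitions,
no named facts.

## References

* M. Eminenti, G. La Nave, C. Mantegazza, *Ricci solitons: the equation point of view*,
  manuscripta math. 127 (2008) 345–367 (arXiv:math/0607546), Prop. 2.1 and §3.
  [EminentiLanaveMantegazza2008]
* O. Munteanu, J. Wang, *Structure at infinity for shrinking Ricci solitons*, arXiv:1606.01861,
  §2 (p. 6). [MunteanuWang2016]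
* T. Ivey, *Ricci solitons on compact three-manifolds*, Diff. Geom. Appl. 3 (1993). [Ivey1993]
-/

noncomputable section

open Bundle Set Function Filter Module
open scoped Manifold ContDiff Topology

namespace Literature.Geometry.Riemannian

open Lorentzian Lorentzian.PseudoRiemannianMetric

section General

variable {E : Type*} [NormedAddCommGroup E] [NormedSpace ℝ E] [FiniteDimensional ℝ E]
  {H : Type*} [TopologicalSpace H] {I : ModelWithCorners ℝ E H} [I.Boundaryless]
  {M : Type*} [TopologicalSpace M] [ChartedSpace H M] [IsManifold I ∞ M]
  (g : PseudoRiemannianMetric I ∞ E (TangentSpace I : M → Type _)) [g.HasLeviCivita]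

/-- **A compact shrinking gradient Ricci soliton has `S ≥ 0`.** Let `g` be a `C^∞` Riemannian
metric on a compact manifold without boundary and `f` a `C^∞` function with `Ric + Hess f = λ g`,
`λ > 0`. Then `S(x) ≥ 0` for every `x`: at a minimum point `x₀` of `S`, `Δ_g S ≥ 0` and `dS = 0`,
so `Δ_g S = g⁻¹(dS, df) + 2λS − 2|Ric|²` gives `|Ric|²(x₀) ≤ λ S(x₀)`; with `S² ≤ n|Ric|²` this
forces `S(x₀) ≥ 0` (Eminenti–La Nave–Mantegazza 2008, §3; the weak form of "`R` must be positive
everywhere"). [cite: EminentiLanaveMantegazza2008, §3 (discussion before Prop. 3.4)] [cite: MunteanuWang2016, §2 (p. 6)] -/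
theorem scalarCurvature_nonneg_of_compactSpace_soliton [CompactSpace M] (hg : g.IsRiemannian)
    {f : M → ℝ} (hf : ContMDiff I 𝓘(ℝ, ℝ) ∞ f) {lam : ℝ} (hlam : 0 < lam)
    (hsol : ∀ (x : M) (X Y : TangentSpace I x),
      g.ricci x X Y + g.hessian f x X Y = lam * g.val x X Y) (x : M) :
    0 ≤ g.scalarCurvature x := by
  have hS : ContMDiff I 𝓘(ℝ, ℝ) ∞ g.scalarCurvature := contMDiff_scalarCurvature g
  obtain ⟨x₀, -, hmin⟩ :=
    isCompact_univ.exists_isMinOn ⟨x, mem_univ x⟩ hS.continuous.continuousOn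
  refine le_trans ?_ (hmin (mem_univ x))
  -- at the minimum point: `Δ S ≥ 0` and `dS = 0`
  have hS2 : ContMDiffAt I 𝓘(ℝ, ℝ) 2 g.scalarCurvature x₀ :=
    (hS.of_le (WithTop.coe_le_coe.mpr le_top)).contMDiffAt
  have hlap : 0 ≤ g.dalembertian g.scalarCurvature x₀ :=
    g.dalembertian_nonneg_of_isLocalMin hS2 (hmin.isLocalMin univ_mem) (hg x₀)
  have hmf : mfderiv I 𝓘(ℝ, ℝ) g.scalarCurvature x₀ = 0 := by
    have hSd : MDifferentiableAt I 𝓘(ℝ, ℝ) g.scalarCurvature x₀ := hS.mdifferentiableAt (by simp)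
    rw [hSd.mfderiv, ModelWithCorners.Boundaryless.range_eq_univ, fderivWithin_univ]
    have hw : writtenInExtChartAt I 𝓘(ℝ, ℝ) x₀ g.scalarCurvature =
        g.scalarCurvature ∘ (extChartAt I x₀).symm := by
      ext z
      simp [writtenInExtChartAt]
    rw [hw]
    apply IsLocalMin.fderiv_eq_zero
    refine Filter.Eventually.of_forall fun z ↦ ?_
    simp only [Function.comp_apply, extChartAt_to_inv]
    exact hmin (mem_univ _)
  have hd : mvfderiv I g.scalarCurvature x₀ = 0 := by
    ext v
    simp [mvfderiv, hmf]
  -- Hamilton's identity at `x₀`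
  have key := dalembertian_scalarCurvature_of_soliton g hf hsol x₀
  rw [hd] at key
  have hinner : g.innerDual x₀ ((0 : TangentSpace I x₀ →L[ℝ] ℝ) : TangentSpace I x₀ →ₗ[ℝ] ℝ)
      (mvfderiv I f x₀ : TangentSpace I x₀ →ₗ[ℝ] ℝ) = 0 := by
    simp [PseudoRiemannianMetric.innerDual]
  rw [hinner, zero_add] at key
  -- `|Ric|² ≤ λ S` at `x₀`, and `S² ≤ n |Ric|²`
  have hRic : g.normSq x₀ (g.ricci x₀) ≤ lam * g.scalarCurvature x₀ := by linarith
  have hCS : g.scalarCurvature x₀ ^ 2 ≤ finrank ℝ E * g.normSq x₀ (g.ricci x₀) :=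
    g.trace_sq_le_finrank_mul_normSq x₀ hg (g.ricci x₀)
  have hn : (0 : ℝ) ≤ finrank ℝ E := Nat.cast_nonneg _
  by_contra hneg
  have hneg : g.scalarCurvature x₀ < 0 := lt_of_not_ge hneg
  have h1 : (finrank ℝ E : ℝ) * g.normSq x₀ (g.ricci x₀) ≤
      finrank ℝ E * (lam * g.scalarCurvature x₀) := mul_le_mul_of_nonneg_left hRic hn
  have h2 : (finrank ℝ E : ℝ) * (lam * g.scalarCurvature x₀) ≤ 0 :=
    mul_nonpos_of_nonneg_of_nonpos hn (mul_nonpos_of_nonneg_of_nonpos hlam.le hneg.le)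
  have h3 : g.scalarCurvature x₀ ^ 2 ≤ 0 := hCS.trans (h1.trans h2)
  have h4 : 0 < g.scalarCurvature x₀ ^ 2 := by
    have : 0 < -g.scalarCurvature x₀ := by linarith
    nlinarith
  linarith

end General

/-! ### The binder of `threeShrinkerClassification_modelData` -/

section Three

/-- **`R ≥ 0` on every compact member of the binder of `threeShrinkerClassification_modelData`**
(`Ric + Hess φ = ½ h`, `λ = ½ > 0`). [cite: EminentiLanaveMantegazza2008, §3 (discussion before Prop. 3.4)]
[cite: MunteanuWang2016, §2 (p. 6)] -/
theorem ThreeShrinker.scalarCurvature_nonneg_of_compactSpace (N : Type*) [TopologicalSpace N]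
    [ChartedSpace (EuclideanSpace ℝ (Fin 3)) N] [IsManifold (𝓡 3) ∞ N] [CompactSpace N]
    (h : PseudoRiemannianMetric (𝓡 3) ∞ (EuclideanSpace ℝ (Fin 3))
      (TangentSpace (𝓡 3) : N → Type _)) [h.HasLeviCivita]
    (φ : N → ℝ) (hh : h.IsRiemannian) (hφ : ContMDiff (𝓡 3) 𝓘(ℝ, ℝ) ∞ φ)
    (hsol : ∀ (x : N) (X Y : TangentSpace (𝓡 3) x),
      h.ricci x X Y + h.hessian φ x X Y = (1 / 2 : ℝ) * h.val x X Y) (x : N) :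
    0 ≤ h.scalarCurvature x :=
  scalarCurvature_nonneg_of_compactSpace_soliton h hh hφ (by norm_num) hsol x

end Three

end Literature.Geometry.Riemannian

end
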